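import Summits.AtomisticToContinuum.HydrodynamicLimit.Theorems.AntiMazurCoboundariesInfluenceLocalityObjects
import Literature.MathematicalPhysics.KineticTheory.HardSphereCanonicalTorus
import Literature.Analysis.FluidPDE.HardSphereCollisionRecord
import Literature.Analysis.FluidPDE.HardSphereFreeStretch
import Literature.Analysis.FluidPDE.HardSphereTorusMeasure

/-!
# Prelim A of stub `stub_trueCapsExist` (line `true-anchored-infection`, crux `InfluenceLocality`,
# stmt-AtomisticToContinuum-13916; route AntiMazurCoboundaries): pathwise kinematics of one sphere

STUB 4 of the line (`TrueCapsExist`) bounds the `G_N`-probability that some true sphere is fast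
(relative speed `> u`) at SOME time of `[0, Tℓ]` while near the initial position of sphere `i`.
The supremum over a continuum of times is reduced to TWO static-looking events by the remark that
velocities only change at collisions: a sphere that is fast at time `s` was either fast at time
`0`, or became fast at its last collision before `s` — a term of a COLLISION SUM, which the
collision-flux (Rice) inequality `measure_collisionSum_ge_le_liminf` of
`KineticTheory/CollisionFluxUpperBound` controls under the stationary law. This file proves the
pathwise half of that reduction, for a hard-sphere trajectory `γ` on `𝕋³`
(`IsHardSphereTrajectory`, e.g. a good orbit of any `HardSphereFlow`):

* `TrueCaps.vel_eq_of_forall_not_participates` — the velocity of sphere `j` does not change on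
  `[a, b]` if `j` takes part in no collision at the times of `(a, b]` (free flight between the
  collisions of the others, `collidePair_apply_of_ne` at them; a locally-constant argument);
* `TrueCaps.euclidDist_le_of_norm_vel_le` — a sphere of speed `≤ V` on `[a, b]` moves (minimal
  image) by at most `V (b - a)` (real induction over the free stretches);
* `TrueCaps.exists_flightStart` — the FLIGHT-START ALTERNATIVE: for `s ≥ 0` there is
  `r ∈ [0, s]` with `v_j(s) = v_j(r)`, `dist(x_j(s), x_j(r)) ≤ ‖v_j(r)‖ (s - r)`, and either
  `r = 0` or `r` is a collision time at which `j` is in contact with some `k ≠ j`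
  (`flightStart` of `HardSphereCollisionRecord`);
* `trueCaps_fast_decomp` (registered prelim) and `TrueCaps.fast_decomp₀` — the consequence for a
  good orbit of a flow `Φ : Flow σ N`: if sphere `j` is fast and within `ρ` of sphere `i` at some
  time of `[0, τ]`, and `i` has speed `≤ V` on `[0, τ]`, then either this already holds at time
  `0` with radius `ρ + (‖v_j(0)‖ + V) τ`, or at some collision time `r ∈ [0, τ]` sphere `j` is in
  contact with some `k ≠ j`, fast, and within `ρ + (‖v_j(r)‖ + V) τ` of `i` — the summand of the
  collision sum that the Rice inequality bounds.
-/

namespace Summit.AtomisticToContinuum.HydrodynamicLimit.Theorems.TrueAnchoredInfection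

open MeasureTheory Set Filter Topology
open scoped ENNReal
open Literature.Analysis.FluidPDE Literature.MathematicalPhysics.KineticTheory
open Literature.Analysis.FunctionSpaces

noncomputable section

namespace TrueCaps

variable {n : ℕ} {ε : ℝ} {γ : ℝ → Config n (Fin 3) T3}

/-! ## Velocities of a non-participating sphere -/

/-- At a collision time at which `j` does not participate, the velocity of `j` is that of the
left limit. -/
theorem vel_eq_leftLim_of_not_participates (h : IsHardSphereTrajectory G3 ε n γ) {t : ℝ}
    (ht : t ∈ collisionTimes G3 ε γ) {j : Fin n} (hj : ¬ Participates G3 ε (γ t) j)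
    {zl : Config n (Fin 3) T3} (hzl : Tendsto γ (𝓝[<] t) (𝓝 zl)) : (γ t j).2 = (zl j).2 := by
  obtain ⟨p, q, hpq, hc⟩ := ht
  obtain ⟨-, zl', hzl', -, heq⟩ := h.binary t p q hpq hc
  have hzz : zl' = zl := tendsto_nhds_unique hzl' hzl
  subst hzz
  have hpc : (p, q) ∈ contactPairs G3 ε (γ t) := mem_contactPairs.2 ⟨hpq, hc⟩
  have hjp : j ≠ p := fun hjp => hj ⟨q, Or.inl (hjp ▸ hpc)⟩
  have hjq : j ≠ q := fun hjq => hj ⟨p, Or.inr (hjq ▸ hpc)⟩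
  rw [heq, collidePair_apply_of_ne hjp hjq]

/-- **A non-participating sphere keeps its velocity.** If sphere `j` takes part in no collision
at the times of `(a, b]`, then `v_j(b) = v_j(a)`. -/
theorem vel_eq_of_forall_not_participates (h : IsHardSphereTrajectory G3 ε n γ) {a b : ℝ}
    (hab : a ≤ b) {j : Fin n} (hnp : ∀ t ∈ Ioc a b, ¬ Participates G3 ε (γ t) j) :
    (γ b j).2 = (γ a j).2 := by
  -- the velocity of `j` read through the clamp `t ↦ max a (min t b)` is locally constant on `ℝ`
  set g : ℝ → ℝ := fun t => max a (min t b) with hg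
  set f : ℝ → V3 := fun t => (γ (g t) j).2 with hf
  have hga : g a = a := by simp [hg, hab]
  have hgb : g b = b := by simp [hg, hab]
  have hloc : IsLocallyConstant f := by
    refine (IsLocallyConstant.iff_eventually_eq _).2 fun t => ?_
    rcases lt_or_ge t a with hta | hta
    · filter_upwards [eventually_lt_nhds hta] with y hy
      simp only [hf, hg, max_eq_left (min_le_of_left_le hy.le), max_eq_left (min_le_of_left_le hta.le)]
    rcases lt_or_ge b t with hbt | htb
    · filter_upwards [eventually_gt_nhds hbt] with y hy
      simp only [hf, hg, min_eq_right hy.le, min_eq_right hbt.le]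
    -- `a ≤ t ≤ b`: use the free stretches on both sides of `t`
    have hgt : g t = t := by simp [hg, hta, htb]
    obtain ⟨s₀, hs₀t, hfreel⟩ := h.exists_Ioo_left_free t
    obtain ⟨u₀, htu₀, hfreer⟩ := h.exists_Ioo_right_free t
    -- to the right of `t` (inside `[t, u₀)`) the trajectory is the free flight from `γ t`
    have hright : ∀ y, t ≤ y → y < u₀ → f y = (γ t j).2 := by
      intro y hty hyu
      have hgy : g y ∈ Ico t u₀ := by
        refine ⟨le_max_of_le_right (le_min hty htb), ?_⟩
        exact max_lt (lt_of_le_of_lt hta htu₀) (lt_of_le_of_lt (min_le_left _ _) hyu)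
      simp only [hf]
      rw [h.eq_freeFlight_of_Ioo_free hfreer hgy, freeFlight_apply]
    rcases hta.eq_or_lt with rfl | hat
    · -- `t = a`: to the left of `a` the clamp is constant
      filter_upwards [Ioo_mem_nhds (show a - 1 < a by linarith) htu₀] with y hy
      rcases lt_or_ge y a with hyt | hty
      · simp only [hf, hg, max_eq_left (min_le_of_left_le hyt.le), min_eq_left hab, max_self]
      · rw [hright y hty hy.2]
        simp only [hf, hga]
    · -- `a < t ≤ b`: to the left, free flight on `(s₀, t)` and no jump of `v_j` at `t`
      have hm : max s₀ a < t := max_lt hs₀t hat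
      filter_upwards [Ioo_mem_nhds hm htu₀] with y hy
      rcases lt_or_ge y t with hyt | hty
      · have hay : a ≤ y := (le_max_right _ _).trans hy.1.le
        have hgy : g y = y := by simp [hg, hay, (hyt.le.trans htb)]
        have hsy : s₀ < y := (le_max_left _ _).trans_lt hy.1
        have hfree' : ∀ σ ∈ Ioo y t, σ ∉ collisionTimes G3 ε γ := fun σ hσ =>
          hfreel σ ⟨hsy.trans hσ.1, hσ.2⟩
        simp only [hf, hgy, hgt]
        by_cases htc : t ∈ collisionTimes G3 ε γ
        · have hzl := h.tendsto_nhdsLT Torus.continuous_geometry_translate hyt hfree'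
          rw [vel_eq_leftLim_of_not_participates h htc (hnp t ⟨hat, htb⟩) hzl, freeFlight_apply]
        · rw [h.free y t hyt.le fun σ hσ => ?_, freeFlight_apply]
          rcases hσ.2.eq_or_lt with rfl | hlt
          · exact htc
          · exact hfree' σ ⟨hσ.1, hlt⟩
      · rw [hright y hty hy.2]
        simp only [hf, hgt]
  have := hloc.apply_eq_of_preconnectedSpace b a
  simpa only [hf, hga, hgb] using this

/-- On an interval at whose times (after the left end) `j` does not participate, the velocity of
`j` is constant. -/
theorem vel_eq_of_forall_not_participates' (h : IsHardSphereTrajectory G3 ε n γ) {a b : ℝ}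
    {j : Fin n} (hnp : ∀ t ∈ Ioc a b, ¬ Participates G3 ε (γ t) j) {t : ℝ} (ht : t ∈ Icc a b) :
    (γ t j).2 = (γ a j).2 :=
  vel_eq_of_forall_not_participates h ht.1 fun s hs => hnp s ⟨hs.1, hs.2.trans ht.2⟩

/-! ## Displacement of a sphere of bounded speed -/

/-- **A sphere of speed `≤ V` on `[a, b]` moves by at most `V (b - a)`** (minimal-image distance on
`𝕋³`; real induction over the free stretches, continuity of positions). -/
theorem euclidDist_le_of_norm_vel_le (h : IsHardSphereTrajectory G3 ε n γ) {a b : ℝ} (hab : a ≤ b)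
    {j : Fin n} {V : ℝ} (hV : ∀ t ∈ Icc a b, ‖(γ t j).2‖ ≤ V) :
    Torus.euclidDist (γ b j).1 (γ a j).1 ≤ V * (b - a) := by
  let S : Set ℝ := {t | Torus.euclidDist (γ t j).1 (γ a j).1 ≤ V * (t - a)}
  have hcont : Continuous fun t => Torus.euclidDist (γ t j).1 (γ a j).1 :=
    (Torus.continuous_norm_reprSym (d := Fin 3)).comp ((h.pos_continuous j).sub continuous_const)
  have hclosed : IsClosed S := isClosed_le hcont (continuous_const.mul (continuous_id.sub continuous_const))
  have haS : a ∈ S := by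
    show Torus.euclidDist (γ a j).1 (γ a j).1 ≤ V * (a - a)
    rw [Torus.euclidDist_self, sub_self, mul_zero]
  have key : Icc a b ⊆ S := by
    refine (hclosed.inter isClosed_Icc).Icc_subset_of_forall_mem_nhdsWithin haS ?_
    rintro x ⟨hxS, hxa, hxb⟩
    obtain ⟨u₀, hxu₀, hfree⟩ := h.exists_Ioo_right_free x
    have hVx : ‖(γ x j).2‖ ≤ V := hV x ⟨hxa, hxb.le⟩
    filter_upwards [Ioo_mem_nhdsGT hxu₀] with y hy
    have hflight : γ y = freeFlight G3 (y - x) (γ x) := h.eq_freeFlight_of_Ioo_free hfree ⟨hy.1.le, hy.2⟩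
    have hpos : (γ y j).1 = (γ x j).1 + Torus.proj ((y - x) • (γ x j).2) := by
      rw [hflight, freeFlight_apply, Torus.geometry_translate]
    have hstep : Torus.euclidDist (γ y j).1 (γ x j).1 ≤ V * (y - x) := by
      have h1 := Torus.euclidDist_translate_le (γ x j).1 (γ x j).1 ((y - x) • (γ x j).2) 0
      rw [Torus.proj_zero, add_zero, sub_zero, Torus.euclidDist_self, zero_add, ← hpos] at h1
      refine h1.trans ?_
      rw [norm_smul, Real.norm_of_nonneg (by linarith [hy.1]), mul_comm]
      exact mul_le_mul_of_nonneg_right hVx (by linarith [hy.1])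
    show Torus.euclidDist (γ y j).1 (γ a j).1 ≤ V * (y - a)
    calc Torus.euclidDist (γ y j).1 (γ a j).1
        ≤ Torus.euclidDist (γ y j).1 (γ x j).1 + Torus.euclidDist (γ x j).1 (γ a j).1 :=
          euclidDist_triangle _ _ _
      _ ≤ V * (y - x) + V * (x - a) := add_le_add hstep hxS
      _ = V * (y - a) := by ring
  exact key ⟨hab, le_rfl⟩

/-! ## The flight-start alternative -/

/-- A participating sphere is in contact with a sphere other than itself (ordered form used by
collision sums). -/
theorem exists_contact_of_participates (h : IsHardSphereTrajectory G3 ε n γ) {t : ℝ} {j : Fin n}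
    (hj : Participates G3 ε (γ t) j) :
    t ∈ collisionTimes G3 ε γ ∧ ∃ k, j ≠ k ∧ ‖G3.sepVec (γ t j).1 (γ t k).1‖ = ε := by
  refine ⟨mem_collisionTimes_iff_exists_participates.2 ⟨j, hj⟩, ?_⟩
  obtain ⟨k, hk⟩ := hj
  have hne : j ≠ k := hk.ne
  rcases hk with hjk | hkj
  · exact ⟨k, hne, ((mem_contactPairs_iff_of_mem (h.mem t)).1 hjk).2⟩
  · refine ⟨k, hne, ?_⟩
    have h2 := ((mem_contactPairs_iff_of_mem (h.mem t)).1 hkj).2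
    rw [Torus.norm_geometry_sepVec] at h2 ⊢
    rwa [Torus.euclidDist_comm]

/-- **The flight-start alternative.** For `s ≥ 0` and a sphere `j` there is a time `r ∈ [0, s]`
with `v_j(s) = v_j(r)` and `dist(x_j(s), x_j(r)) ≤ ‖v_j(r)‖ (s - r)`, such that either `r = 0` or
`r` is a collision time at which `j` is in contact with some sphere `k ≠ j` (so that `v_j(r)` is
its post-collisional velocity: the trajectory is right-continuous). -/
theorem exists_flightStart (h : IsHardSphereTrajectory G3 ε n γ) (j : Fin n) {s : ℝ} (hs : 0 ≤ s) :
    ∃ r ∈ Icc 0 s, (γ s j).2 = (γ r j).2 ∧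
      Torus.euclidDist (γ s j).1 (γ r j).1 ≤ ‖(γ r j).2‖ * (s - r) ∧
      (r = 0 ∨ (r ∈ collisionTimes G3 ε γ ∧ ∃ k, j ≠ k ∧ ‖G3.sepVec (γ r j).1 (γ r k).1‖ = ε)) := by
  by_cases hpart : Participates G3 ε (γ s) j
  · refine ⟨s, ⟨hs, le_rfl⟩, rfl, ?_, Or.inr (exists_contact_of_participates h hpart)⟩
    simp
  set r := flightStart G3 ε γ 0 j s with hr
  have hmem := h.flightStart_mem 0 j s
  rw [← hr] at hmem
  have hrs : r ∈ Icc 0 s := by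
    rcases mem_insert_iff.1 hmem with h0 | h0
    · exact ⟨h0.ge, h0 ▸ hs⟩
    · exact ⟨h0.2.1.le, h0.2.2.le⟩
  have hnp : ∀ t ∈ Ioc r s, ¬ Participates G3 ε (γ t) j := by
    intro t ht
    rcases ht.2.eq_or_lt with rfl | hlt
    · exact hpart
    · exact h.not_participates_of_mem_Ioo_flightStart (a := 0) ⟨ht.1, hlt⟩
  have hvel : ∀ t ∈ Icc r s, (γ t j).2 = (γ r j).2 := fun t ht =>
    vel_eq_of_forall_not_participates' h hnp ht
  refine ⟨r, hrs, hvel s ⟨hrs.2, le_rfl⟩, ?_, ?_⟩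
  · exact euclidDist_le_of_norm_vel_le h hrs.2 fun t ht => le_of_eq (by rw [hvel t ht])
  · rcases mem_insert_iff.1 hmem with h0 | h0
    · exact Or.inl h0
    · exact Or.inr (exists_contact_of_participates h h0.1)

end TrueCaps

/-! ## The consequence for good orbits of a flow -/

open TrueCaps in
/-- **Registered prelim `trueCaps_fast_decomp`** (of `stub_trueCapsExist`). On a good orbit of a
flow of `N + 1` spheres of diameter `σℓ`: if sphere `j` has velocity `u`-far from `c` and lies
within `ρ` of sphere `i` at some time `s ∈ [0, τ]`, while sphere `i` has speed `≤ V` on `[0, τ]`,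
then EITHER at time `0` sphere `j` is already `u`-far from `c` and within `ρ + (‖v_j(0)‖ + V) τ`
of sphere `i`, OR at some collision time `r ∈ [0, τ]` sphere `j` is in contact with some sphere
`k ≠ j`, is `u`-far from `c`, and lies within `ρ + (‖v_j(r)‖ + V) τ` of sphere `i`. -/
theorem trueCaps_fast_decomp : ∀ (σ : ℝ) (N : ℕ) (Φ : Flow σ N) (z : Phase N), z ∈ Φ.good → ∀ (i j : Fin (N + 1)) (c : V3) (τ u ρ V : ℝ), (∀ t ∈ Set.Icc 0 τ, ‖(Φ.flow t z i).2‖ ≤ V) → (∃ s ∈ Set.Icc 0 τ, u < ‖(Φ.flow s z j).2 - c‖ ∧ Torus.euclidDist (Φ.flow s z j).1 (Φ.flow s z i).1 < ρ) → (u < ‖(z j).2 - c‖ ∧ Torus.euclidDist (z j).1 (z i).1 < ρ + (‖(z j).2‖ + V) * τ) ∨ ∃ r ∈ collisionTimes G3 (hsDiameter σ N) (fun t => Φ.flow t z) ∩ Set.Icc 0 τ, ∃ k, j ≠ k ∧ ‖G3.sepVec (Φ.flow r z j).1 (Φ.flow r z k).1‖ = hsDiameter σ N ∧ u < ‖(Φ.flow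 r z j).2 - c‖ ∧ Torus.euclidDist (Φ.flow r z j).1 (Φ.flow r z i).1 < ρ + (‖(Φ.flow r z j).2‖ + V) * τ := by
  intro σ N Φ z hz i j c τ u ρ V hi hs
  obtain ⟨s, hsτ, hfast, hnear⟩ := hs
  have h := Φ.isTrajectory z hz
  obtain ⟨r, hrs, hvel, hdisp, halt⟩ := exists_flightStart h j hsτ.1
  have hV0 : 0 ≤ V := (norm_nonneg _).trans (hi 0 ⟨le_rfl, hsτ.1.trans hsτ.2⟩)
  have hrτ : r ∈ Icc 0 τ := ⟨hrs.1, hrs.2.trans hsτ.2⟩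
  -- displacement of `i` on `[r, s]`
  have hdi : Torus.euclidDist (Φ.flow s z i).1 (Φ.flow r z i).1 ≤ V * (s - r) :=
    euclidDist_le_of_norm_vel_le h hrs.2 fun t ht => hi t ⟨hrs.1.trans ht.1, ht.2.trans hsτ.2⟩
  have hfast' : u < ‖(Φ.flow r z j).2 - c‖ := by rwa [← hvel]
  have hnear' : Torus.euclidDist (Φ.flow r z j).1 (Φ.flow r z i).1 < ρ + (‖(Φ.flow r z j).2‖ + V) * τ := by
    have hsr : s - r ≤ τ := by linarith [hrs.1, hsτ.2]
    have hsr0 : 0 ≤ s - r := by linarith [hrs.2]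
    calc Torus.euclidDist (Φ.flow r z j).1 (Φ.flow r z i).1
        ≤ Torus.euclidDist (Φ.flow r z j).1 (Φ.flow s z j).1 +
            Torus.euclidDist (Φ.flow s z j).1 (Φ.flow r z i).1 := euclidDist_triangle _ _ _
      _ ≤ Torus.euclidDist (Φ.flow r z j).1 (Φ.flow s z j).1 +
            (Torus.euclidDist (Φ.flow s z j).1 (Φ.flow s z i).1 +
              Torus.euclidDist (Φ.flow s z i).1 (Φ.flow r z i).1) :=
          add_le_add le_rfl (euclidDist_triangle _ _ _)
      _ < ‖(Φ.flow r z j).2‖ * (s - r) + (ρ + V * (s - r)) := by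
          rw [Torus.euclidDist_comm]
          exact add_lt_add_of_le_of_lt hdisp (add_lt_add_of_lt_of_le hnear hdi)
      _ = ρ + (‖(Φ.flow r z j).2‖ + V) * (s - r) := by ring
      _ ≤ ρ + (‖(Φ.flow r z j).2‖ + V) * τ :=
          add_le_add le_rfl (mul_le_mul_of_nonneg_left hsr (add_nonneg (norm_nonneg _) hV0))
  rcases halt with rfl | ⟨hrc, k, hjk, hcontact⟩
  · left
    have h0 : Φ.flow 0 z = z := Φ.flow_zero z hz
    simp only [h0] at hfast' hnear'
    exact ⟨hfast', hnear'⟩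
  · right
    exact ⟨r, ⟨hrc, hrτ⟩, k, hjk, hcontact, hfast', hnear'⟩

namespace TrueCaps

/-- The same alternative without the anchor sphere: if sphere `j` has velocity `u`-far from `c`
at some time of `[0, τ]`, then either already at time `0`, or at some collision time `r ∈ [0, τ]`
at which `j` is in contact with some `k ≠ j`. -/
theorem fast_decomp₀ {σ : ℝ} {N : ℕ} (Φ : Flow σ N) {z : Phase N} (hz : z ∈ Φ.good)
    (j : Fin (N + 1)) (c : V3) {τ u : ℝ}
    (hs : ∃ s ∈ Icc 0 τ, u < ‖(Φ.flow s z j).2 - c‖) :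
    u < ‖(z j).2 - c‖ ∨ ∃ r ∈ collisionTimes G3 (hsDiameter σ N) (fun t => Φ.flow t z) ∩ Icc 0 τ,
      ∃ k, j ≠ k ∧ ‖G3.sepVec (Φ.flow r z j).1 (Φ.flow r z k).1‖ = hsDiameter σ N ∧
        u < ‖(Φ.flow r z j).2 - c‖ := by
  obtain ⟨s, hsτ, hfast⟩ := hs
  obtain ⟨r, hrs, hvel, -, halt⟩ := exists_flightStart (Φ.isTrajectory z hz) j hsτ.1
  have hfast' : u < ‖(Φ.flow r z j).2 - c‖ := by rwa [← hvel]
  rcases halt with rfl | ⟨hrc, k, hjk, hcontact⟩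
  · left
    rwa [Φ.flow_zero z hz] at hfast'
  · exact Or.inr ⟨r, ⟨hrc, hrs.1, hrs.2.trans hsτ.2⟩, k, hjk, hcontact, hfast'⟩

end TrueCaps

end

end Summit.AtomisticToContinuum.HydrodynamicLimit.Theorems.TrueAnchoredInfection
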